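import Summits.BirchSwinnertonDyer.BirchSwinnertonDyer.Theorems.AdditiveKolyvaginRoadManinFrameResidueProperRTameTwistPotGood
import Summits.BirchSwinnertonDyer.BirchSwinnertonDyer.Theorems.AdditiveKolyvaginRoadManinFrameResidueProperTwistDegree
import HarnessLib

/-!
# Route `AdditiveKolyvaginRoad`, crux `ManinFrameResidueProperR` (stmt-BirchSwinnertonDyer-20709), line
# `tame-twist`, stub S57 ON the Kosters–Pannekoek locus (`p ∈ {5, 7}`, Kodaira II/III at `5`, II at `7`):
# the stub is EQUIVALENT to the Manin-free TWIST-DEGREE STEP, granted the Kato–Kosters–Pannekoek fact F″,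
# Dokchitser–Dokchitser and modularity (`--supports`, helper)

Cell `pub/bsd-wall`, seat `bsd-wall-manin-p1` g5. THEOREMS ONLY (no definition, no named fact, no `sorry`);
nothing is closed. After `…RTameTwistPotGood` (p583992) the research content of stub S57 of line `tame-twist` is
the KOSTERS–PANNEKOEK LOCUS: frames `(W, p)`, `p ∈ {5, 7}`, `W` additive and potentially good at `p` with
`v₅(Δ_min W) ∈ {2, 3}` resp. `v₇(Δ_min W) = 2` — the UNSTARRED Kodaira types II/III, on which some member of the
class may carry a `ℚ_p`-rational point of order `p`, so that Kato's integrality in Néron units says nothing about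
the `X₀(N)`-optimal curve of the class of `W`. This file is the `p ∈ {5, 7}` twin of
`…ManinFrameResidueProperTwistDegree` (g0, `p ≥ 11`, Edixhoven): it TRANSLATES the stub there into a statement
with no Manin constant, no Néron lattice and no Heegner frame, using Kato (fact F″) on the STARRED twist class in
place of Edixhoven 1991 Thm. 3:

* §1 `exists_twistDatum_not_dvd_of_kato57` — for `V/ℚ` globally minimal, additive at `p ∈ {5, 7}`, `E[p]`
  irreducible, potentially good with `v_p(Δ_min V) < 6` (types II/III/IV), and a globally minimal model `W♭`
  of `V ⊗ χ_{p*}`: **`W♭` carries a conductor-level datum with `p ∤ c`**, GRANTED F″ and Dokchitser–Dokchitser.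
  Indeed `W♭` is additive, potentially good, with `v_p(Δ_min W♭) = v_p(Δ_min V) + 6 ≥ 6`
  (`Additive.addv_of_twist_pStar`), `E♭[p]` is irreducible (twist), so NO member of the class of `W♭` has a
  `ℚ_p`-rational point of order `p` (`forall_member_noPTorsion_of_four_le`: Mazur's Step 1 at `p ≥ 5` on
  `4 ≤ v_p(Δ_min)`, transported by DD under `Irr`) and g4's `p ∈ {5, 7}` tame-twist lever
  `exists_member_not_dvd_c_of_tameTwist57_of_four_le` gives a member of the class of `W♭` with a Manin-unit
  datum; prime-to-`p` transport (`ManinFrameTransport…of_partner`) moves it to `W♭`.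
* §2 `padicVal_modularDegree_lt_of_not_dvd_c'` — the cell's `p`-adic twist identity
  `v_p(deg D♭) + 2·v_p(c(D)) = v_p(deg D) + 2·v_p(c(D♭)) + 1` (`Additive.padicVal_twist_identity`, `p ≥ 5`,
  hypotheses `Addv V p`, `0 ≤ v_p(j V)`, `v_p(Δ_min V) < 6` — NO (G)-ordinarity) read with `p ∤ c(D)`; the other
  reading is the tree's `MemberManinUnitFiveSevenGlue.not_dvd_c_of_padicVal_modularDegree_lt'` (route
  EdixhovenFibreFiveSeven's glue G57, seat bsd-line-edix-p2 — whose §4 is the K★-conditional twin of §1 here; that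
  module imports its route file, so the eight lines are repeated inline in §3 rather than imported).
* §3 `exists_member_not_dvd_c_of_twistDegreeStep57` / `twistDegreeStep57_of_exists_member_not_dvd_c` /
  `exists_member_not_dvd_c_iff_twistDegreeStep57` — **at an AKR pair `(W, p)`, `p ∈ {5, 7}`, `Addv`, `Irr`,
  with a potentially good member `V ∼ W` of `v_p(Δ_min V) < 6` and a globally minimal model `W♭` of
  `V ⊗ χ_{p*}`: (∃ globally minimal `W₀ ∼ W` with a datum at level `N(W)` having `p ∤ c`) ⟺ (TDS) (∃ a
  conductor-level datum `D` of `V` with `v_p(deg D) < v_p(deg D♭)` for every conductor-level datum `D♭` of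
  `W♭`)**, GRANTED `hnf`, F″, DD (⟸ uses all three; ⟹ only `hnf`).
* §§4–5 (stub S57-T from (TDS) at the frame curve; route EdixhovenFibreFiveSeven's TDS57 off the locus from F″) are
  in the sequel file `…RTameTwistKPStub`.

UPSHOT for the planners: on line `tame-twist` the ONLY mathematics not in print is, uniformly in `p ≥ 5`,
Edixhoven's §4 dichotomy «case 1 never occurs»: the optimal degree of the STARRED `p*`-twist class has one more
factor `p` than a conductor-level degree of the unstarred curve — at `p ≥ 11` Kato's reciprocity law settles it
(g3, p573163), at `p ∈ {5, 7}` it settles it off the Kosters–Pannekoek locus (g4 + p583992), and ON that locus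
(49 of 1 159 residue cells with `N ≤ 5·10⁵`, all with Cremona's `c₀ = 1`) it is exactly (TDS). BSD is not
proved by any of this.

References: [EdixhovenManin1991] Thm. 3, Prop. 7, §4 (cases 1/2); [Kato2004Asterisque] (8.1.3), Thm. 9.7,
Thm. 6.6; [KimNakamura2020] Cor. 2.4; [KostersPannekoek2017] Thm. 1, Cor. 2;
[DokchitserDokchitser2015LocalInvariants] Thm. 5.1 (1); [ZagierCMB1985] §1; [Pal2012] Prop. 2.5;
[Mazur1977] III §5 Step 1.
-/

set_option autoImplicit false
set_option linter.dupNamespace false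

noncomputable section

open scoped Classical

open WeierstrassCurve NumberField Literature.NumberTheory.EllipticCurves
  Literature.NumberTheory.EllipticCurves.ModularForms
  Literature.NumberTheory.EllipticCurves.Rank1Residual
  Literature.NumberTheory.DiophantineGeometry IsDedekindDomain Rat.HeightOneSpectrum
  Summit.BirchSwinnertonDyer.Rank1Residual Summit.BirchSwinnertonDyer.Rank1Residual.Additive

namespace Summit.BirchSwinnertonDyer.BirchSwinnertonDyer.Theorems.ManinFrameResidueProperRTameTwist

/-! ### §0 Bookkeeping: moving a datum along an equality of levels -/

/-- A datum with `p ∤ c` at level `N` is one at any level `M = N` (`subst`). [folklore] -/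
private theorem exists_datum_not_dvd_of_level_eq' {W : WeierstrassCurve ℚ} {N M : ℕ} [NeZero N]
    [NeZero M] (h : N = M) {p : ℕ} (D : ModularParametrizationData W N) (hc : ¬ (p : ℤ) ∣ D.c) :
    ∃ D' : ModularParametrizationData W M, ¬ (p : ℤ) ∣ D'.c := by
  subst h
  exact ⟨D, hc⟩

/-! ### §1 The starred twist carries a datum with `p ∤ c` (Kato on the twisted class, `p ∈ {5, 7}`) -/

section Twist

variable {p : ℕ} [hp : Fact p.Prime]

/-- **The `p*`-twist of an unstarred potentially good curve has a conductor-level datum with `p ∤ c`,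
`p ∈ {5, 7}`, GRANTED F″ and Dokchitser–Dokchitser.** `V/ℚ` globally minimal, additive at `p` with `E[p]`
irreducible, `0 ≤ v_p(j V)`, `v_p(Δ_min V) < 6`; `W♭` globally minimal with `C • V^{(p*)} = W♭`. Then `W♭` is
additive and potentially good at `p` with `6 ≤ v_p(Δ_min W♭)` (`Additive.addv_of_twist_pStar`), `E♭[p]` is
irreducible (`hasIrreducibleModPGaloisRep_of_smul_eq_quadraticTwist`), hence no globally minimal member of the
class of `W♭` has a `ℚ_p`-rational point of order `p` and the `p ∈ {5, 7}` tame-twist lever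
(`exists_member_not_dvd_c_of_tameTwist57_of_four_le`, Kato (8.1.3)/9.7/6.6 + Kim–Nakamura in Néron units at the
lattice-optimal member) yields a member `W₀ ∼ W♭` with a datum at level `N(W♭)` having `p ∤ c`; the prime-to-`p`
transport under `Irr` (`ManinFrameTransport.exists_modularParametrizationData_not_dvd_of_partner`) moves it to `W♭`.
[cite: Kato2004Asterisque, (8.1.3) (p. 180), Thm. 9.7 (p. 189)] [cite: KostersPannekoek2017, Thm. 1 and Cor. 2]
[cite: DokchitserDokchitser2015LocalInvariants, Thm. 5.1 (1)] [cite: SilvermanAEC2009, X.5 Cor. 5.4] -/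
theorem exists_twistDatum_not_dvd_of_kato57
    (hK : kato_neron_isIntegral_twistedSymbolSum_of_additive_five_le)
    (hDD : dokchitser_padicValInt_minimalDiscriminantInt_eq_of_isogeny_of_not_dvd_degree)
    (hnf : exists_isNewformOf) (hp57 : p = 5 ∨ p = 7)
    (V : WeierstrassCurve ℚ) [V.IsElliptic] [V.IsGloballyMinimal] (hV : Addv V p) (hirrV : Irr V p)
    (hj : 0 ≤ padicValRat p V.j) (hV6 : padicValInt p V.minimalDiscriminantInt < 6)
    (Wf : WeierstrassCurve ℚ) [Wf.IsElliptic] [Wf.IsGloballyMinimal] [NeZero (Wf.conductorNorm ℤ)]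
    (C : VariableChange ℚ) (hC : C • V.quadraticTwist ((-1 : ℚ) ^ (p / 2) * p) = Wf) :
    ∃ Df : ModularParametrizationData Wf (Wf.conductorNorm ℤ), ¬ (p : ℤ) ∣ Df.c := by
  have hp5 : 5 ≤ p := by rcases hp57 with rfl | rfl <;> norm_num
  have hp2 : p ≠ 2 := by omega
  -- the twist is additive, potentially good, with `v_p(Δ_min) ≥ 6`
  obtain ⟨haddf, hjf, h6⟩ := addv_of_twist_pStar p hp2 V Wf hj hV6 C hC
  -- `E♭[p]` is irreducible
  have hd0 : ((-1 : ℚ) ^ (p / 2) * p) ≠ 0 :=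
    mul_ne_zero (pow_ne_zero _ (by norm_num)) (by exact_mod_cast hp.out.ne_zero)
  have hC' : C⁻¹ • Wf = V.quadraticTwist ((-1 : ℚ) ^ (p / 2) * p) := by rw [← hC, inv_smul_smul]
  have hirrf : Irr Wf p :=
    BurungaleSkinnerTianWan2024.hasIrreducibleModPGaloisRep_of_smul_eq_quadraticTwist V Wf p hd0
      hC' hirrV
  -- the tame-twist lever on the class of `W♭` (no local `p`-torsion there: `4 ≤ v_p(Δ_min)`)
  obtain ⟨W₀, hE₀, hM₀, D₀, hiso, hc₀⟩ :=
    exists_member_not_dvd_c_of_tameTwist57_of_four_le hK hDD hnf Wf hp57 haddf hirrf hjf (by omega)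
  haveI := hE₀
  haveI := hM₀
  -- prime-to-`p` transport back to `W♭`
  exact ManinFrameTransport.exists_modularParametrizationData_not_dvd_of_partner Wf hp.out hirrf hiso D₀ hc₀

end Twist

/-! ### §2 The `p`-adic twist identity read with a Manin-unit datum of the twist (`p ≥ 5`, no (G)-ordinarity) -/

section Identity

variable {p : ℕ} [hp : Fact p.Prime]

/-- **`p ∤ c(D)` forces `v_p(deg D) < v_p(deg D♭)` for EVERY datum `D♭` of the twist** (`p ≥ 5`; `V` additive,
potentially good, `v_p(Δ_min V) < 6`; `W♭` a globally minimal model of `V ⊗ χ_{p*}`): the cell's twist identity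
`v_p(deg D♭) + 2·v_p(c(D)) = v_p(deg D) + 2·v_p(c(D♭)) + 1` (`Additive.padicVal_twist_identity`) read with
`v_p(c(D)) = 0`. The other reading (`v_p(deg D) < v_p(deg D♭)` and `p ∤ c(D♭)` ⟹ `p ∤ c(D)`) is the tree's
`MemberManinUnitFiveSevenGlue.not_dvd_c_of_padicVal_modularDegree_lt'` (route EdixhovenFibreFiveSeven, item G57;
not imported here to stay out of that route's theses cone — the eight lines are repeated inside §3). [cite: ZagierCMB1985, §1 (p. 374)] [cite: Pal2012, Prop. 2.5] -/
theorem padicVal_modularDegree_lt_of_not_dvd_c' (hp5 : 5 ≤ p) (V Wf : WeierstrassCurve ℚ)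
    [V.IsElliptic] [V.IsGloballyMinimal] [Wf.IsElliptic] [Wf.IsGloballyMinimal] (hV : Addv V p)
    (hj : 0 ≤ padicValRat p V.j) (hV6 : padicValInt p V.minimalDiscriminantInt < 6)
    (C : VariableChange ℚ) (hC : C • V.quadraticTwist ((-1 : ℚ) ^ (p / 2) * p) = Wf)
    [NeZero (V.conductorNorm ℤ)] [NeZero (Wf.conductorNorm ℤ)]
    (D : ModularParametrizationData V (V.conductorNorm ℤ)) (hc : ¬ (p : ℤ) ∣ D.c)
    (Df : ModularParametrizationData Wf (Wf.conductorNorm ℤ)) :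
    padicValNat p D.modularDegree < padicValNat p Df.modularDegree := by
  have h := padicVal_twist_identity p hp5 V Wf hV hj hV6 C hC D Df
  have hc0 : padicValInt p D.maninConstant = 0 := padicValInt.eq_zero_of_not_dvd hc
  omega

end Identity

/-! ### §3 The stub's conclusion ⟺ the twist-degree step (TDS), `p ∈ {5, 7}` -/

section Step

variable {p : ℕ} [hp : Fact p.Prime]

/-- **(TDS) ⟹ a member with a Manin-unit datum, `p ∈ {5, 7}`, GRANTED F″, DD and modularity.** For an AKR pair
`(W, p)` — `W/ℚ` globally minimal, `Addv W p`, `Irr W p` — with a potentially good globally minimal member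
`V ∼ W` of `v_p(Δ_min V) < 6` and a globally minimal model `W♭` of `V ⊗ χ_{p*}`: if some conductor-level datum
`D` of `V` has `v_p(deg D) < v_p(deg D♭)` for every conductor-level datum `D♭` of `W♭`, then some globally minimal
member (namely `V`) carries a datum at level `N(W)` with `p ∤ c` (§1 and §2; levels `N(V) = N(W)` by modularity).
[cite: Kato2004Asterisque, (8.1.3) (p. 180), Thm. 9.7 (p. 189)] [cite: DokchitserDokchitser2015LocalInvariants, Thm. 5.1 (1)]
[cite: ZagierCMB1985, §1 (p. 374)] -/
theorem exists_member_not_dvd_c_of_twistDegreeStep57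
    (hK : kato_neron_isIntegral_twistedSymbolSum_of_additive_five_le)
    (hDD : dokchitser_padicValInt_minimalDiscriminantInt_eq_of_isogeny_of_not_dvd_degree)
    (hnf : exists_isNewformOf)
    (W : WeierstrassCurve ℚ) [W.IsElliptic] [W.IsGloballyMinimal] [NeZero (W.conductorNorm ℤ)]
    (hp57 : p = 5 ∨ p = 7) (hadd : Addv W p) (hirr : Irr W p)
    {V : WeierstrassCurve ℚ} [V.IsElliptic] [V.IsGloballyMinimal] [NeZero (V.conductorNorm ℤ)]
    (hisoV : IsIsogenous W V) (hj : 0 ≤ padicValRat p V.j) (hV6 : padicValInt p V.minimalDiscriminantInt < 6)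
    {Wf : WeierstrassCurve ℚ} [Wf.IsElliptic] [Wf.IsGloballyMinimal] [NeZero (Wf.conductorNorm ℤ)]
    (C : VariableChange ℚ) (hC : C • V.quadraticTwist ((-1 : ℚ) ^ (p / 2) * p) = Wf)
    (hStep : ∃ D : ModularParametrizationData V (V.conductorNorm ℤ),
      ∀ Df : ModularParametrizationData Wf (Wf.conductorNorm ℤ),
        padicValNat p D.modularDegree < padicValNat p Df.modularDegree) :
    ∃ (W₀ : WeierstrassCurve ℚ) (_ : W₀.IsElliptic) (_ : W₀.IsGloballyMinimal)
        (D₀ : ModularParametrizationData W₀ (W.conductorNorm ℤ)),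
        IsIsogenous W W₀ ∧ ¬ (p : ℤ) ∣ D₀.c := by
  have hp5 : 5 ≤ p := by rcases hp57 with rfl | rfl <;> norm_num
  obtain ⟨D, hD⟩ := hStep
  have hirrV : Irr V p := (X12.irr_iff_of_isIsogenous hisoV p).mp hirr
  have hV : Addv V p := (X2.addv_iff_of_isIsogenous (p := p) hisoV).mp hadd
  obtain ⟨Df, hcf⟩ := exists_twistDatum_not_dvd_of_kato57 hK hDD hnf hp57 V hV hirrV hj hV6 Wf C hC
  -- the twist identity `v_p(deg D♭) + 2 v_p(c(D)) = v_p(deg D) + 2 v_p(c(D♭)) + 1` read with `p ∤ c(D♭)`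
  -- (as in `MemberManinUnitFiveSevenGlue.not_dvd_c_of_padicVal_modularDegree_lt'`, route EdixhovenFibreFiveSeven)
  have hc : ¬ (p : ℤ) ∣ D.c := by
    have h := padicVal_twist_identity p hp5 V Wf hV hj hV6 C hC D Df
    have hcf0 : padicValInt p Df.maninConstant = 0 := padicValInt.eq_zero_of_not_dvd hcf
    have hlt := hD Df
    intro hdvd
    have hne : D.maninConstant ≠ 0 := D.maninConstant_ne_zero_holds
    have h1 : 1 ≤ padicValInt p D.maninConstant := by
      have h' : (p : ℤ) ^ 1 ∣ D.maninConstant := by rw [pow_one]; exact hdvd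
      rw [padicValInt_dvd_iff] at h'
      exact h'.resolve_left hne
    omega
  -- the level `N(V) = N(W)`
  have hN : V.conductorNorm ℤ = W.conductorNorm ℤ :=
    IsNewformOf.level_eq_conductorNorm_of_exists_isNewformOf hnf (D.isNewformOf.of_isIsogenous hisoV)
  obtain ⟨D', hc'⟩ := exists_datum_not_dvd_of_level_eq' hN D hc
  exact ⟨V, ‹_›, ‹_›, D', hisoV, hc'⟩

/-- **A member with a Manin-unit datum ⟹ (TDS)** (`p ≥ 5`; only modularity is used, for `N(W) = N(V)`): if some
globally minimal `W₀ ∼ W` has a datum at level `N(W)` with `p ∤ c`, then — transporting it prime-to-`p` to the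
potentially good member `V` (`Irr`) — `V` has a conductor-level datum `D` with `p ∤ c(D)`, whence
`v_p(deg D) < v_p(deg D♭)` for every conductor-level datum `D♭` of the twist (§2). [cite: ZagierCMB1985, §1 (p. 374)]
[cite: Pal2012, Prop. 2.5] -/
theorem twistDegreeStep57_of_exists_member_not_dvd_c (hnf : exists_isNewformOf)
    (W : WeierstrassCurve ℚ) [W.IsElliptic] [W.IsGloballyMinimal] [NeZero (W.conductorNorm ℤ)]
    (hp5 : 5 ≤ p) (hadd : Addv W p) (hirr : Irr W p)
    {V : WeierstrassCurve ℚ} [V.IsElliptic] [V.IsGloballyMinimal] [NeZero (V.conductorNorm ℤ)]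
    (hisoV : IsIsogenous W V) (hj : 0 ≤ padicValRat p V.j) (hV6 : padicValInt p V.minimalDiscriminantInt < 6)
    {Wf : WeierstrassCurve ℚ} [Wf.IsElliptic] [Wf.IsGloballyMinimal] [NeZero (Wf.conductorNorm ℤ)]
    (C : VariableChange ℚ) (hC : C • V.quadraticTwist ((-1 : ℚ) ^ (p / 2) * p) = Wf)
    (h : ∃ (W₀ : WeierstrassCurve ℚ) (_ : W₀.IsElliptic) (_ : W₀.IsGloballyMinimal)
        (D₀ : ModularParametrizationData W₀ (W.conductorNorm ℤ)),
        IsIsogenous W W₀ ∧ ¬ (p : ℤ) ∣ D₀.c) :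
    ∃ D : ModularParametrizationData V (V.conductorNorm ℤ),
      ∀ Df : ModularParametrizationData Wf (Wf.conductorNorm ℤ),
        padicValNat p D.modularDegree < padicValNat p Df.modularDegree := by
  obtain ⟨W₀, hE₀, hM₀, D₀, hiso₀, hc₀⟩ := h
  haveI := hE₀
  haveI := hM₀
  have hirrV : Irr V p := (X12.irr_iff_of_isIsogenous hisoV p).mp hirr
  have hV : Addv V p := (X2.addv_iff_of_isIsogenous (p := p) hisoV).mp hadd
  have hisoV₀ : IsIsogenous V W₀ := (hisoV.symm_of_charZero).trans' hiso₀
  obtain ⟨D, hc⟩ :=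
    ManinFrameTransport.exists_modularParametrizationData_not_dvd_of_partner V hp.out hirrV hisoV₀ D₀ hc₀
  have hN : W.conductorNorm ℤ = V.conductorNorm ℤ :=
    IsNewformOf.level_eq_conductorNorm_of_exists_isNewformOf hnf D.isNewformOf
  obtain ⟨D', hc'⟩ := exists_datum_not_dvd_of_level_eq' hN D hc
  exact ⟨D', fun Df ↦ padicVal_modularDegree_lt_of_not_dvd_c' hp5 V Wf hV hj hV6 C hC D' hc' Df⟩

/-- **THE TRANSLATION at `p ∈ {5, 7}`: the conclusion of stub S57 ⟺ (TDS)** at every AKR pair `(W, p)` with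
`Addv W p`, `Irr W p`, for every potentially good globally minimal member `V ∼ W` with `v_p(Δ_min V) < 6` and every
globally minimal model `W♭` of `V ⊗ χ_{p*}` — GRANTED modularity, the Kato–Kosters–Pannekoek fact F″ and
Dokchitser–Dokchitser 2015 Thm. 5.1 (1). So ON the Kosters–Pannekoek locus the open content of the crux is
Edixhoven's «case 2» of op. cit. §4 read at `p ∈ {5, 7}`: the optimal degree of the STARRED twist class has at
least one more factor `p` than some conductor-level degree of the unstarred member.
[cite: EdixhovenManin1991, §4 (cases 1/2)] [cite: Kato2004Asterisque, Thm. 9.7 (p. 189)]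
[cite: DokchitserDokchitser2015LocalInvariants, Thm. 5.1 (1)] [cite: ZagierCMB1985, §1 (p. 374)] -/
theorem exists_member_not_dvd_c_iff_twistDegreeStep57
    (hK : kato_neron_isIntegral_twistedSymbolSum_of_additive_five_le)
    (hDD : dokchitser_padicValInt_minimalDiscriminantInt_eq_of_isogeny_of_not_dvd_degree)
    (hnf : exists_isNewformOf)
    (W : WeierstrassCurve ℚ) [W.IsElliptic] [W.IsGloballyMinimal] [NeZero (W.conductorNorm ℤ)]
    (hp57 : p = 5 ∨ p = 7) (hadd : Addv W p) (hirr : Irr W p)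
    {V : WeierstrassCurve ℚ} [V.IsElliptic] [V.IsGloballyMinimal] [NeZero (V.conductorNorm ℤ)]
    (hisoV : IsIsogenous W V) (hj : 0 ≤ padicValRat p V.j) (hV6 : padicValInt p V.minimalDiscriminantInt < 6)
    {Wf : WeierstrassCurve ℚ} [Wf.IsElliptic] [Wf.IsGloballyMinimal] [NeZero (Wf.conductorNorm ℤ)]
    (C : VariableChange ℚ) (hC : C • V.quadraticTwist ((-1 : ℚ) ^ (p / 2) * p) = Wf) :
    (∃ (W₀ : WeierstrassCurve ℚ) (_ : W₀.IsElliptic) (_ : W₀.IsGloballyMinimal)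
        (D₀ : ModularParametrizationData W₀ (W.conductorNorm ℤ)),
        IsIsogenous W W₀ ∧ ¬ (p : ℤ) ∣ D₀.c) ↔
    (∃ D : ModularParametrizationData V (V.conductorNorm ℤ),
      ∀ Df : ModularParametrizationData Wf (Wf.conductorNorm ℤ),
        padicValNat p D.modularDegree < padicValNat p Df.modularDegree) := by
  have hp5 : 5 ≤ p := by rcases hp57 with rfl | rfl <;> norm_num
  exact ⟨twistDegreeStep57_of_exists_member_not_dvd_c hnf W hp5 hadd hirr hisoV hj hV6 C hC,
    exists_member_not_dvd_c_of_twistDegreeStep57 hK hDD hnf W hp57 hadd hirr hisoV hj hV6 C hC⟩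

end Step

end Summit.BirchSwinnertonDyer.BirchSwinnertonDyer.Theorems.ManinFrameResidueProperRTameTwist

end
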